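import Literature.AlgebraicGeometry.Resolution.Mulay1983SmoothCentres
import Literature.AlgebraicGeometry.Resolution.Mulay1983LambdaIdeal
import Literature.AlgebraicGeometry.Resolution.Mulay1983EquimultipleFinite
import Literature.AlgebraicGeometry.Resolution.ExcellentRingsCompleteHolds
import Literature.AlgebraicGeometry.Resolution.FormalCoordinateChange
import Mathlib.RingTheory.Ideal.KrullsHeightTheorem
import HarnessLib

/-!
# Mulay's hyperplanarity theorem for smooth centres through a Weierstrass direction
# (Mulay 1983, Main Theorem §4, in `L⟦x₀, x_σ⟧`)

Topic: `Literature/AlgebraicGeometry/Resolution`. Core assembly of the discharge of the named fact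
`Mulay1983_codimTwoHyperplanar` (`Mulay1983Hyperplanarity.lean`); S. B. Mulay, *Equimultiplicity and
hyperplanarity*, Proc. Amer. Math. Soc. **89** (1983) 407–413 (lit key `paper:url-29aeafb0cf6c`),
§4 MAIN THEOREM: «Let `R` be an excellent regular local domain containing a field. Let `F` be a nonzero
principal ideal in `R`, contained in `m(R)`. Then the 2-codimensional equimultiple locus of `(R, F)` is
hyperplanar.» — proof p. 413: E¹-reduction, Weierstrass form `f(Z) ∈ S[Z]` (2.6), finiteness (1.2),
`Λ(J) = B` (3.9), «there exists `t ∈ S` with `(z + t) ∈ P` for all `P ∈ Π²`».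

We PROVE (`exists_forall_mem_of_smooth`) the following case, which is what the typed statement
`Mulay1983_codimTwoHyperplanar` needs after a choice of coordinates: `R = L⟦x_{Option σ}⟧` (`L` a field,
`σ` finite), `g ∈ 𝔪_R^ν` with `[x_none^ν] g ≠ 0` (`g` regular of order `ν ≥ 1` in the direction
`x_none`; Mulay 2.6); conclusion: ONE `ζ ∈ 𝔪_R ∖ 𝔪_R²` lying in every SMOOTH two-codimensional centre
`P = (w, v)` — `w` with linear part `x_none`, `v` with an independent linear part — such that
`g ∈ P^ν` (`= P^{(ν)}`: `P ∈ E²(R, gR)`). Assembly: normal form `P ↦ (T − θ_P, q_P)`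
(`Mulay1983SmoothCentres`), Taylor conditions (`Mulay1983WeierstrassShift`), finiteness unless
`g = h^ν·unit` (`Mulay1983EquimultipleFinite`; then `ζ = h`), rigidity/deduplication (3.5), and the
`Λ`-ideal argument (`Mulay1983LambdaIdeal`) giving `τ ∈ S` with `ζ = x_none + τ` (Mulay's `z + t`).

No statement of H. Hironaka's 2017 manuscript is involved. AI formalisation; weaker than expert
review.

## References
* S. B. Mulay, *Equimultiplicity and hyperplanarity*, Proc. Amer. Math. Soc. 89 (1983) 407–413,
  §4 Main Theorem and its proof (p. 413), with 1.2, 2.6, 3.5, 3.9. [Mulay1983]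
-/

noncomputable section

namespace Literature.AlgebraicGeometry.Resolution

namespace Mulay1983

open IsLocalRing Polynomial Literature.RingTheory.MvPowerSeries

universe u v

variable {L : Type u} [Field L] {σ : Type v} [Finite σ]

/-- **Mulay 1983, Main Theorem (§4), for smooth centres through the Weierstrass direction.** Let
`R = L⟦x_{Option σ}⟧`, `ν ≥ 1`, and `g ∈ R` with all coefficients of degree `< ν` zero and
`[x_none^ν] g ≠ 0`. Then there is `ζ ∈ R` with zero constant term and a non-zero linear term (a regular
parameter) such that `ζ ∈ (w, v)` for all `w, v ∈ 𝔪_R` with: the linear part of `w` is `x_none`, some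
`x_{some s}`-coefficient of `v` is non-zero, and `g ∈ (w, v)^ν` — «there exists `t ∈ S` with
`(z + t) ∈ P` for all `P ∈ Π²(S[z], f(z)S[z], d)`».
[cite: Mulay1983, §4 Main Theorem (proof, p. 413)] -/
theorem exists_forall_mem_of_smooth {ν : ℕ} (hν : ν ≠ 0) (g : MvPowerSeries (Option σ) L)
    (hgν : ∀ e : Option σ →₀ ℕ, e.degree < ν → MvPowerSeries.coeff e g = 0)
    (hgT : MvPowerSeries.coeff (Finsupp.single none ν) g ≠ 0) :
    ∃ ζ : MvPowerSeries (Option σ) L, MvPowerSeries.constantCoeff ζ = 0 ∧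
      (∃ o, MvPowerSeries.coeff (Finsupp.single o 1) ζ ≠ 0) ∧
      ∀ w v : MvPowerSeries (Option σ) L,
        MvPowerSeries.constantCoeff w = 0 → MvPowerSeries.coeff (Finsupp.single none 1) w = 1 →
        (∀ s : σ, MvPowerSeries.coeff (Finsupp.single (some s) 1) w = 0) →
        MvPowerSeries.constantCoeff v = 0 →
        (∃ s : σ, MvPowerSeries.coeff (Finsupp.single (some s) 1) v ≠ 0) →
        g ∈ (Ideal.span {w, v}) ^ ν → ζ ∈ Ideal.span {w, v} := by
  classical
  -- the rings
  haveI : IsRegularLocalRing (MvPowerSeries (Option σ) L) := isRegularLocalRing_mvPowerSeries L (Option σ)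
  haveI : IsRegularRing (MvPowerSeries (Option σ) L) := isRegularRing_mvPowerSeries L (Option σ)
  haveI : IsDomain (MvPowerSeries (Option σ) L) := isDomain_of_isRegularLocalRing (MvPowerSeries (Option σ) L)
  haveI : IsAdicComplete (maximalIdeal (MvPowerSeries (Option σ) L)) (MvPowerSeries (Option σ) L) := by
    rw [maximalIdeal_mvPowerSeries_eq_span L (Option σ)]; infer_instance
  have hJ2 : IsJ2Ring (MvPowerSeries (Option σ) L) := isJ2Ring_of_isAdicComplete (MvPowerSeries (Option σ) L)
  haveI : IsRegularLocalRing (MvPowerSeries σ L) := isRegularLocalRing_mvPowerSeries L σ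
  haveI : IsRegularRing (MvPowerSeries σ L) := isRegularRing_mvPowerSeries L σ
  haveI : IsDomain (MvPowerSeries σ L) := isDomain_of_isRegularLocalRing (MvPowerSeries σ L)
  haveI : IsAdicComplete (maximalIdeal (MvPowerSeries σ L)) (MvPowerSeries σ L) := by
    rw [maximalIdeal_mvPowerSeries_eq_span L σ]; infer_instance
  set E : MvPowerSeries (Option σ) L ≃+* PowerSeries (MvPowerSeries σ L) := optionEquivLeft with hEdef
  -- membership transport along `E`
  have hmemE : ∀ (P : Ideal (MvPowerSeries (Option σ) L)) (x : MvPowerSeries (Option σ) L),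
      x ∈ P ↔ E x ∈ P.map E.toRingHom := by
    intro P x
    refine ⟨fun h => Ideal.mem_map_of_mem E.toRingHom h, fun h => ?_⟩
    have h2 := Ideal.mem_map_of_mem E.symm.toRingHom h
    rw [Ideal.map_map] at h2
    simpa [Ideal.map_id] using h2
  -- the order of `g` is `ν`
  have hgm : g ∈ maximalIdeal (MvPowerSeries (Option σ) L) ^ ν := Jets.mem_maximalIdeal_pow_of_coeff_eq_zero hgν
  have hgord : adicOrder g = ν := by
    refine le_antisymm ?_ ((le_adicOrder_iff g ν).mpr hgm)
    rw [adicOrder_le_iff]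
    intro h
    exact hgT (Jets.coeff_eq_zero_of_mem_maximalIdeal_pow h
      (show (Finsupp.single (none : Option σ) ν).degree < ν + 1 by simp))
  have hg0 : g ≠ 0 := fun h => hgT (by rw [h, map_zero])
  -- admissible centres are the primes `(x_none − ιθ, ιq)`
  have hadm : ∀ w v : MvPowerSeries (Option σ) L, MvPowerSeries.constantCoeff w = 0 → MvPowerSeries.coeff (Finsupp.single none 1) w = 1 →
      (∀ s : σ, MvPowerSeries.coeff (Finsupp.single (some s) 1) w = 0) → MvPowerSeries.constantCoeff v = 0 →
      (∃ s : σ, MvPowerSeries.coeff (Finsupp.single (some s) 1) v ≠ 0) →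
      ∃ θ q : MvPowerSeries σ L, MvPowerSeries.constantCoeff θ = 0 ∧ Prime q ∧
        (Ideal.span {w, v}).map E.toRingHom = Ideal.span {PowerSeries.X - PowerSeries.C θ, PowerSeries.C q} := by
    intro w v hw0 hw1 hws hv0 hvs
    obtain ⟨θ, q, hθ, hq0, ⟨s, hs⟩, hmap⟩ := exists_normalForm w v hw0 hw1 hws hv0 hvs
    exact ⟨θ, q, hθ, prime_of_coeff_single_ne_zero hq0 hs, hmap⟩
  have hprimeA : ∀ (θ q : MvPowerSeries σ L), MvPowerSeries.constantCoeff θ = 0 → Prime q →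
      (Ideal.span ({PowerSeries.X - PowerSeries.C θ, PowerSeries.C q} : Set (PowerSeries (MvPowerSeries σ L)))).IsPrime := by
    intro θ q hθ hq
    obtain ⟨ev, -, -, hcomap⟩ := exists_eval θ hθ
    rw [hcomap q]
    haveI := (Ideal.span_singleton_prime hq.ne_zero).mpr hq
    exact Ideal.comap_isPrime ev _
  have hprimeR : ∀ (P : Ideal (MvPowerSeries (Option σ) L)) (θ q : MvPowerSeries σ L), MvPowerSeries.constantCoeff θ = 0 → Prime q →
      P.map E.toRingHom = Ideal.span {PowerSeries.X - PowerSeries.C θ, PowerSeries.C q} → P.IsPrime := by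
    intro P θ q hθ hq hmap
    have : P = (Ideal.span {PowerSeries.X - PowerSeries.C θ, PowerSeries.C q}).comap E.toRingHom := by
      rw [← hmap]; exact (Ideal.comap_map_of_bijective E.toRingHom E.bijective).symm
    rw [this]
    haveI := hprimeA θ q hθ hq
    exact Ideal.comap_isPrime E.toRingHom _
  -- CASE `E¹ ≠ ∅`: `g = h^ν · unit`, take `ζ = h`
  by_cases hE1 : ∃ h c : MvPowerSeries (Option σ) L, IsUnit c ∧ adicOrder h = 1 ∧ g = h ^ ν * c
  · obtain ⟨h, c, hc, hh1, hghc⟩ := hE1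
    have hhm : h ∈ maximalIdeal (MvPowerSeries (Option σ) L) := by
      have := (le_adicOrder_iff h 1).mp (by rw [hh1]; exact le_rfl)
      rwa [pow_one] at this
    have hhm2 : h ∉ maximalIdeal (MvPowerSeries (Option σ) L) ^ 2 := by
      rw [← le_adicOrder_iff, hh1]; exact fun hle => absurd hle (by decide)
    refine ⟨h, Jets.mem_maximalIdeal_iff_constantCoeff_eq_zero.mp hhm, ?_, ?_⟩
    · by_contra hnone
      push Not at hnone
      apply hhm2
      refine Jets.mem_maximalIdeal_pow_of_coeff_eq_zero fun e he => ?_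
      rcases FormalCoordChange.eq_zero_or_single_of_degree_lt_two e he with rfl | ⟨o, rfl⟩
      · exact Jets.mem_maximalIdeal_iff_constantCoeff_eq_zero.mp hhm
      · exact hnone o
    · intro w v hw0 hw1 hws hv0 hvs hgP
      obtain ⟨θ, q, hθ, hq, hmap⟩ := hadm w v hw0 hw1 hws hv0 hvs
      haveI hP := hprimeR _ θ q hθ hq hmap
      have hgP' : h ^ ν * c ∈ Ideal.span {w, v} := hghc ▸ Ideal.pow_le_self hν hgP
      rcases hP.mem_or_mem hgP' with h1 | h1
      · exact hP.mem_of_pow_mem ν h1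
      · exact absurd (Ideal.eq_top_of_isUnit_mem _ h1 hc) hP.ne_top
  · -- CASE `E¹ = ∅`
    -- Weierstrass data of `gA = E g` (Mulay 2.6 / 2.4)
    set gA : PowerSeries (MvPowerSeries σ L) := E g with hgAdef
    have hcoefA : ∀ m, MvPowerSeries.constantCoeff (PowerSeries.coeff m gA) =
        MvPowerSeries.coeff (Finsupp.single none m) g := fun m => by
      rw [hgAdef, hEdef, constantCoeff_coeff_optionEquivLeft]
    have hres : ∀ m, PowerSeries.coeff m (gA.map (residue (MvPowerSeries σ L))) = 0 ↔
        MvPowerSeries.coeff (Finsupp.single none m) g = 0 := by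
      intro m
      rw [PowerSeries.coeff_map, residue_eq_zero_iff, Jets.mem_maximalIdeal_iff_constantCoeff_eq_zero, hcoefA]
    have horder : (gA.map (residue (MvPowerSeries σ L))).order = ν := by
      rw [PowerSeries.order_eq_nat]
      refine ⟨fun h => hgT ((hres ν).mp h), fun i hi => (hres i).mpr (hgν _ ?_)⟩
      simpa using hi
    have hgA0 : gA.map (residue (MvPowerSeries σ L)) ≠ 0 := by
      intro h
      have := congrArg PowerSeries.order h
      rw [horder, PowerSeries.order_zero] at this
      exact ENat.coe_ne_top ν this
    set f : (MvPowerSeries σ L)[X] := gA.weierstrassDistinguished hgA0 with hfdef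
    have H := gA.isWeierstrassFactorization_weierstrassDistinguished_weierstrassUnit hgA0
    have hfdeg : f.natDegree = ν := by
      have h := H.natDegree_eq_toNat_order_map_of_ne_top (maximalIdeal.isMaximal (MvPowerSeries σ L)).ne_top
      rw [← hfdef] at h
      rw [h]
      change (gA.map (residue (MvPowerSeries σ L))).order.toNat = ν
      rw [horder]; rfl
    have hfmon : f.Monic := H.isDistinguishedAt.monic
    obtain ⟨uu, huu⟩ := H.isUnit
    have hfg : (f : PowerSeries (MvPowerSeries σ L)) = gA * ↑uu⁻¹ := by
      rw [H.eq_mul, ← hfdef, ← huu, mul_assoc, Units.mul_inv, mul_one]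
    -- the family of admissible centres containing `g` to order `ν`
    let Adm : Ideal (MvPowerSeries (Option σ) L) → Prop := fun P => ∃ w v : MvPowerSeries (Option σ) L,
        MvPowerSeries.constantCoeff w = 0 ∧
        MvPowerSeries.coeff (Finsupp.single none 1) w = 1 ∧
        (∀ s : σ, MvPowerSeries.coeff (Finsupp.single (some s) 1) w = 0) ∧
        MvPowerSeries.constantCoeff v = 0 ∧
        (∃ s : σ, MvPowerSeries.coeff (Finsupp.single (some s) 1) v ≠ 0) ∧ P = Ideal.span {w, v}
    let 𝓠 : Set (Ideal (MvPowerSeries (Option σ) L)) := {P | Adm P ∧ g ∈ P ^ ν}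
    -- normal form data (3.1 (iii))
    have hnf : ∀ P ∈ 𝓠, ∃ θ q : MvPowerSeries σ L, MvPowerSeries.constantCoeff θ = 0 ∧ Prime q ∧
        P.map E.toRingHom = Ideal.span {PowerSeries.X - PowerSeries.C θ, PowerSeries.C q} := by
      rintro P ⟨⟨w, v, hw0, hw1, hws, hv0, hvs, rfl⟩, -⟩
      exact hadm w v hw0 hw1 hws hv0 hvs
    choose! θf qf hθf hqf hmapf using hnf
    -- Taylor conditions (3.3)
    have hT : ∀ P ∈ 𝓠, ∀ m, qf P ^ (ν - m) ∣ (taylor (θf P) f).coeff m := by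
      intro P hP m
      obtain ⟨sh, hX, hC⟩ := exists_shift (θf P) (hθf P hP)
      have hfmem : (f : PowerSeries (MvPowerSeries σ L)) ∈
          (Ideal.span {PowerSeries.X - PowerSeries.C (θf P), PowerSeries.C (qf P)}) ^ ν := by
        rw [← hmapf P hP, ← Ideal.map_pow, hfg]
        exact Ideal.mul_mem_right _ _ (Ideal.mem_map_of_mem E.toRingHom hP.2)
      exact taylor_coeff_dvd_of_coe_mem_pow sh hX hC (qf P) hfmem m
    -- primality, antichain (3.5), heights
    have hprime : ∀ P ∈ 𝓠, P.IsPrime := fun P hP =>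
      hprimeR P (θf P) (qf P) (hθf P hP) (hqf P hP) (hmapf P hP)
    have hcomapE : ∀ P : Ideal (MvPowerSeries (Option σ) L), (P.map E.toRingHom).comap E.toRingHom = P := fun P =>
      Ideal.comap_map_of_bijective E.toRingHom E.bijective
    have hanti : ∀ P ∈ 𝓠, ∀ P' ∈ 𝓠, P ≤ P' → P = P' := by
      intro P hP P' hP' hle
      have hleA : Ideal.span {PowerSeries.X - PowerSeries.C (θf P), PowerSeries.C (qf P)} ≤
          Ideal.span {PowerSeries.X - PowerSeries.C (θf P'), PowerSeries.C (qf P')} := by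
        rw [← hmapf P hP, ← hmapf P' hP']; exact Ideal.map_mono hle
      have heq := span_X_sub_C_eq_of_le (hθf P' hP') (hqf P hP) (hqf P' hP') hleA
      rw [← hmapf P hP, ← hmapf P' hP'] at heq
      rw [← hcomapE P, heq, hcomapE]
    have hht : ∀ P ∈ 𝓠, P.height ≤ 2 := by
      rintro P ⟨⟨w, v, hw0, hw1, hws, hv0, hvs, rfl⟩, hgP⟩
      have hP : Ideal.span {w, v} ∈ 𝓠 := ⟨⟨w, v, hw0, hw1, hws, hv0, hvs, rfl⟩, hgP⟩
      have hne : Ideal.span {w, v} ≠ ⊤ := (hprime _ hP).ne_top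
      calc (Ideal.span {w, v}).height ≤ (Ideal.span ({w, v} : Set (MvPowerSeries (Option σ) L))).spanFinrank :=
            Ideal.height_le_spanFinrank _ hne
        _ ≤ (({w, v} : Set (MvPowerSeries (Option σ) L)).ncard : ℕ) := by
            exact_mod_cast Submodule.spanFinrank_span_le_ncard_of_finite (Set.toFinite _)
        _ ≤ 2 := by
            have : ({w, v} : Set (MvPowerSeries (Option σ) L)).ncard ≤ 2 := (Set.ncard_insert_le w {v}).trans (by simp)
            exact_mod_cast this
    -- finiteness (1.2)
    have hfin : 𝓠.Finite := by
      rcases finite_or_exists_eq_pow_mul hJ2 hν hgord 𝓠 hprime hanti hht (fun P hP => hP.2) with h | ⟨h, c, hc, hh, hg⟩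
      · exact h
      · exact absurd ⟨h, c, hc, hh, hg⟩ hE1
    haveI : Finite 𝓠 := hfin.to_subtype
    let q : 𝓠 → MvPowerSeries σ L := fun P => qf P.1
    let θ : 𝓠 → MvPowerSeries σ L := fun P => θf P.1
    -- pairwise non-associated: `Q` determines `P` (3.4 (ii), 3.5)
    have hqa : ∀ i j : 𝓠, Associated (q i) (q j) → i = j := by
      intro i j hij
      have hTi : ∀ m < f.natDegree, q i ∣ (taylor (θ i) f).coeff m := fun m hm => by
        have h1 := hT i.1 i.2 m
        rw [hfdeg] at hm
        obtain ⟨k, hk⟩ : ∃ k, ν - m = k + 1 := ⟨ν - m - 1, by omega⟩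
        rw [hk, pow_succ] at h1
        exact (dvd_mul_left _ _).trans h1
      have hTj : ∀ m < f.natDegree, q i ∣ (taylor (θ j) f).coeff m := fun m hm => by
        have h1 := hT j.1 j.2 m
        rw [hfdeg] at hm
        obtain ⟨k, hk⟩ : ∃ k, ν - m = k + 1 := ⟨ν - m - 1, by omega⟩
        rw [hk, pow_succ] at h1
        exact hij.dvd.trans ((dvd_mul_left _ _).trans h1)
      have h1 := map_eq_X_sub_C_pow_of_taylor hfmon hTi
      have h2 := map_eq_X_sub_C_pow_of_taylor hfmon hTj
      rw [h1, hfdeg] at h2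
      haveI : (Ideal.span {q i}).IsPrime := (Ideal.span_singleton_prime (hqf _ i.2).ne_zero).mpr (hqf _ i.2)
      have h3 := eq_of_X_sub_C_pow_eq (D := MvPowerSeries σ L ⧸ Ideal.span {q i}) hν h2
      have h4 : q i ∣ θ i - θ j := Ideal.mem_span_singleton.mp (Ideal.Quotient.eq.mp h3)
      have h5 := span_X_sub_C_eq_of_associated (S := MvPowerSeries σ L) hij h4
      apply Subtype.ext
      rw [← hcomapE i.1, hmapf _ i.2]
      change Ideal.comap E.toRingHom (Ideal.span {PowerSeries.X - PowerSeries.C (θ i), PowerSeries.C (q i)}) = j.1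
      rw [h5]
      change Ideal.comap E.toRingHom (Ideal.span {PowerSeries.X - PowerSeries.C (θf j.1), PowerSeries.C (qf j.1)}) = j.1
      rw [← hmapf _ j.2, hcomapE]
    -- Mulay's `Λ`-lemma (3.9): one `τ` for all centres
    obtain ⟨τ, hτ⟩ := exists_forall_add_mem_span_of_taylor q θ (fun i => hqf _ i.2) hqa f hfmon
      (by rw [hfdeg]; exact Nat.pos_of_ne_zero hν)
      (fun i m _ => by rw [Ideal.mem_span_singleton, hfdeg]; exact hT i.1 i.2 m)
    -- the regular parameter `ζ = x_none + τ` (Mulay's `z + t`)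
    by_cases hempty : 𝓠 = ∅
    · refine ⟨MvPowerSeries.X none, MvPowerSeries.constantCoeff_X _, ⟨none, ?_⟩, ?_⟩
      · rw [MvPowerSeries.coeff_index_single_X, if_pos rfl]; exact one_ne_zero
      · intro w v hw0 hw1 hws hv0 hvs hgP
        have : Ideal.span {w, v} ∈ 𝓠 := ⟨⟨w, v, hw0, hw1, hws, hv0, hvs, rfl⟩, hgP⟩
        rw [hempty] at this
        exact absurd this (Set.notMem_empty _)
    · obtain ⟨P₀, hP₀⟩ := Set.nonempty_iff_ne_empty.mpr hempty
      have hτm : MvPowerSeries.constantCoeff τ = 0 := by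
        have h1 : θ ⟨P₀, hP₀⟩ + τ ∈ Ideal.span {q ⟨P₀, hP₀⟩} := hτ ⟨P₀, hP₀⟩
        have hqm : Ideal.span {q ⟨P₀, hP₀⟩} ≤ maximalIdeal (MvPowerSeries σ L) :=
          IsLocalRing.le_maximalIdeal (by
            rw [Ne, Ideal.span_singleton_eq_top]; exact (hqf _ hP₀).not_unit)
        have h2 := hqm h1
        rw [Jets.mem_maximalIdeal_iff_constantCoeff_eq_zero, map_add] at h2
        change MvPowerSeries.constantCoeff (θf P₀) + _ = 0 at h2
        rwa [hθf _ hP₀, zero_add] at h2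
      set ζ : MvPowerSeries (Option σ) L := MvPowerSeries.X none + E.symm (PowerSeries.C τ) with hζdef
      have hEζ : E ζ = PowerSeries.X + PowerSeries.C τ := by
        rw [hζdef, map_add, hEdef, optionEquivLeft_X_none, RingEquiv.apply_symm_apply]
      refine ⟨ζ, ?_, ⟨none, ?_⟩, ?_⟩
      · rw [hζdef, map_add, MvPowerSeries.constantCoeff_X, zero_add,
          ← MvPowerSeries.coeff_zero_eq_constantCoeff_apply, hEdef, coeff_optionEquivLeft_symm_C]
        simp [hτm]
      · rw [hζdef, map_add, MvPowerSeries.coeff_index_single_X, if_pos rfl, hEdef, coeff_optionEquivLeft_symm_C]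
        simp
      · intro w v hw0 hw1 hws hv0 hvs hgP
        have hP : Ideal.span {w, v} ∈ 𝓠 := ⟨⟨w, v, hw0, hw1, hws, hv0, hvs, rfl⟩, hgP⟩
        rw [hmemE, hmapf _ hP, hEζ]
        have hsplit : PowerSeries.X + PowerSeries.C τ =
            (PowerSeries.X - PowerSeries.C (θf (Ideal.span {w, v}))) +
              PowerSeries.C (θf (Ideal.span {w, v}) + τ) := by rw [map_add]; ring
        rw [hsplit]
        refine Ideal.add_mem _ (Ideal.subset_span (Set.mem_insert _ _)) ?_
        obtain ⟨t, ht⟩ := Ideal.mem_span_singleton.mp (hτ ⟨_, hP⟩)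
        change θf (Ideal.span {w, v}) + τ = qf (Ideal.span {w, v}) * t at ht
        rw [ht, map_mul]
        exact Ideal.mul_mem_right _ _ (Ideal.subset_span (Set.mem_insert_of_mem _ (Set.mem_singleton _)))

end Mulay1983

end Literature.AlgebraicGeometry.Resolution
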